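import Literature.NumberTheory.GaloisRepresentations.PrimaryGeneratorHeckeCharacter
import Literature.NumberTheory.GaloisRepresentations.CubicJacobiSumPrimary
import Mathlib.NumberTheory.NumberField.Cyclotomic.PID
import HarnessLib

/-!
# Primary Eisenstein integers and the CM Hecke character of `ℚ(ω)` of conductor `(3)`

Topic `NumberTheory/GaloisRepresentations`; namespace `Literature.NumberTheory.GaloisRepresentations`.
Everything here is **proved**; there is no named fact.  The Eisenstein case `K = ℚ(ω)`
(`IsCyclotomicExtension {3} ℚ K`; `𝓞 K = ℤ[ω]`, `λ = ω - 1`, `(3) = (λ)²`), `𝔣 = (3)`, of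
`PrimaryGeneratorHeckeCharacter.lean`:

* the unit hypotheses `hinj`, `hsurj` of `PrimaryGeneratorHeckeCharacter.lean` for `𝔣 = (3)` are the
  tree's `units_eq_one_of_sub_one_mem_span_three` (a unit `≡ 1 mod 3` is `1`) and
  `exists_units_mul_sub_one_mem_span_three` (every `x` prime to `3` has a unit multiple `≡ 1 mod 3`)
  of `CubicJacobiSumPrimary.lean` (Ireland–Rosen Ch. 9 §3 Prop. 9.3.5: primary associates);
* `exists_primaryGen_heckeCharacter_three` / `…_cyclotomicField_three` — PRIMARY GENERATORS `ϖ_𝔭`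
  (`𝔭 = (ϖ_𝔭)`, `ϖ_𝔭 ≡ 1 mod 3`, every `𝔭 ∤ 3`; `𝓞 K` is principal, Mathlib `three_pid`) and, for an
  embedding `e : K → ℂ`, an ALGEBRAIC Hecke character `ψ` of `K`, unramified outside `3`, with
  `ψ(ϖ_𝔭) = e(ϖ_𝔭)`: the idelic form of the Größencharakter `χ((α)) = α` (`α` primary) of conductor
  `(3)` and infinity type `(1, 0)` at the place of `e` — the Hecke character of the Fermat cubic /
  `y² = x³ + D` (Ireland–Rosen Ch. 18 §§3–4, §7) and the CM character twisting the `λ`-adic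
  representations of the Picard curves `y³ = f(x)`.  The concrete field `CyclotomicField 3 ℚ` gets the
  `IsCyclotomicExtension` instance by hand (`CyclotomicField.isCyclotomicExtension 3 ℚ`) to sidestep
  the `Algebra ℚ _` instance diamond, as in `CubicResidueSymbol.lean`.

## References

* K. Ireland, M. Rosen, *A Classical Introduction to Modern Number Theory* (1982), Ch. 9 §3
  Prop. 9.3.5; Ch. 18 §4, §7. [IrelandRosen1982]
* A. Weil, *On a certain type of characters of the idèle-class group of an algebraic number-field*
  (1956), §1. [Weil1956]
-/

noncomputable section

open NumberField IsDedekindDomain IsDedekindDomain.HeightOneSpectrum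

namespace Literature.NumberTheory.GaloisRepresentations


/-! ### Primary Eisenstein integers: the units of `ℤ[ω]` modulo `3` -/

section Eisenstein

variable {K : Type*} [Field K] [NumberField K] [IsCyclotomicExtension {3} ℚ K]

omit [IsCyclotomicExtension {3} ℚ K] in
/-- `(3) ≠ 0` in `𝓞 K`. [folklore] -/
theorem span_three_ne_bot : (Ideal.span {(3 : 𝓞 K)} : Ideal (𝓞 K)) ≠ ⊥ := by
  rw [Ne, Ideal.span_singleton_eq_bot]
  norm_num

/-- **Primary generators and the CM Hecke character of `ℚ(ω)`.**  For `K = ℚ(ω)`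
(`IsCyclotomicExtension {3} ℚ K`; `𝓞 K = ℤ[ω]` is principal, Mathlib `three_pid`) and an embedding
`e : K → ℂ` there are PRIMARY GENERATORS `ϖ_𝔭` (`𝔭 = (ϖ_𝔭)`, `ϖ_𝔭 ≡ 1 mod 3`, for every `𝔭 ∤ 3`;
unique, `units_eq_one_of_sub_one_mem_span_three`) and an algebraic Hecke character `ψ` of `K`,
unramified outside `3`, with `ψ(ϖ_𝔭) = e(ϖ_𝔭)` — the idelic form of the Größencharakter
`χ((α)) = α` (`α` primary) of conductor `(3)` and infinity type `(1, 0)` at the place of `e`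
(Ireland–Rosen Ch. 18 §4 / §7: the Hecke character of `y² = x³ + D` and of the Fermat cubic; the CM
character by which the `λ`-adic representations of the Picard curves `y³ = f(x)` are twisted).
[cite: IrelandRosen1982, Ch. 9 §3 Prop. 9.3.5; Ch. 18 §4] [cite: Weil1956, §1] -/
theorem exists_primaryGen_heckeCharacter_three (e : K →+* ℂ) :
    ∃ (ϖ : HeightOneSpectrum (𝓞 K) → 𝓞 K) (ψ : HeckeCharacter K), ψ.IsAlgebraic ∧
      ∀ v : HeightOneSpectrum (𝓞 K), (3 : 𝓞 K) ∉ v.asIdeal →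
        (v.asIdeal = Ideal.span {ϖ v} ∧ ϖ v - 1 ∈ Ideal.span {(3 : 𝓞 K)}) ∧
        ψ.IsUnramifiedAt v ∧ ψ.valueAtUniformizer v = e (ϖ v) := by
  haveI : IsPrincipalIdealRing (𝓞 K) := IsCyclotomicExtension.Rat.three_pid K
  obtain ⟨ζ, hζ⟩ := exists_isPrimitiveRoot_three (K := K)
  have hsurj := exists_units_mul_sub_one_mem_span_three hζ
  have hinj := units_eq_one_of_sub_one_mem_span_three hζ
  obtain ⟨ψ, hψ, hv⟩ := exists_heckeCharacter_primaryGen hsurj hinj span_three_ne_bot e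
  refine ⟨primaryGen hsurj, ψ, ⟨_, _, hψ⟩, fun v h3 => ?_⟩
  have hle : ¬ Ideal.span {(3 : 𝓞 K)} ≤ v.asIdeal := by rwa [Ideal.span_singleton_le_iff_mem]
  exact ⟨⟨(span_primaryGen hsurj hle).symm, primaryGen_sub_one_mem hsurj hle⟩, hv v hle⟩

end Eisenstein

/-- **The case `K = CyclotomicField 3 ℚ`** of `exists_primaryGen_heckeCharacter_three` (the
`IsCyclotomicExtension` instance supplied by hand to sidestep the `Algebra ℚ _` diamond, as in
`CubicResidueSymbol.exists_isPrimitiveRoot_three_cyclotomicField`). [cite: IrelandRosen1982, Ch. 18 §4] -/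
theorem exists_primaryGen_heckeCharacter_cyclotomicField_three (e : CyclotomicField 3 ℚ →+* ℂ) :
    ∃ (ϖ : HeightOneSpectrum (𝓞 (CyclotomicField 3 ℚ)) → 𝓞 (CyclotomicField 3 ℚ))
      (ψ : HeckeCharacter (CyclotomicField 3 ℚ)), ψ.IsAlgebraic ∧
      ∀ v : HeightOneSpectrum (𝓞 (CyclotomicField 3 ℚ)), (3 : 𝓞 (CyclotomicField 3 ℚ)) ∉ v.asIdeal →
        (v.asIdeal = Ideal.span {ϖ v} ∧ ϖ v - 1 ∈ Ideal.span {(3 : 𝓞 (CyclotomicField 3 ℚ))}) ∧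
        ψ.IsUnramifiedAt v ∧ ψ.valueAtUniformizer v = e (ϖ v) :=
  haveI : IsCyclotomicExtension {3} ℚ (CyclotomicField 3 ℚ) := CyclotomicField.isCyclotomicExtension 3 ℚ
  exists_primaryGen_heckeCharacter_three e

end Literature.NumberTheory.GaloisRepresentations

end
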